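import Summits.ResolutionOfSingularities.ResolutionOfSingularities.Theorems.FrobeniusClosingPatchingRelPerfectDepthLegalCurveCentre
import Literature.AlgebraicGeometry.Resolution.StrictNormalCrossingsHasSNC
import Literature.AlgebraicGeometry.Resolution.PrimeDivisorIdeals
import Literature.AlgebraicGeometry.Resolution.StalkIdealGenerization
import Literature.AlgebraicGeometry.Resolution.RsopLocalization
import Literature.AlgebraicGeometry.Resolution.CoefficientIdealRestriction
import Literature.AlgebraicGeometry.Resolution.RegularLocalRingsQuotient
import HarnessLib

/-!
# Crux `PatchingRelPerfect` (stmt-ResolutionOfSingularities-16161), chain W5.2 — T6-E1b residual `LegalScopedDivisorReduction₃`,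
# PHASE 2 closer (2b), spec D4 rule (b): DOUBLE CURVES ARE LEGAL NORMAL-CROSSINGS CENTRES

[OURS · L1 W5.2 · res-L1-w52-lead-1 g5, hand #3b; spec `L/res-L1-w52-lead-1/PHASE2-STEPB-SPEC.md` §D4 ORACLE PLAN, case |A_Γ| ≥ 2]
Replaces the role of NO printed item; NOT a statement of the manuscript under review; fact-free.

Rule (b) of the curve-choosing oracle: if a codimension-two point `γ` of `E` lies on two distinct members `F₂ ≠ F₃` of a boundary
`ℬ` with simple normal crossings, then the reduced curve `Γ = cl{γ}` IS the double curve `F₂ ∩ F₃` near each of its points and `ℬ`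
has simple normal crossings WITH `Γ`: at `x ∈ Γ` the snc coordinates give `F₂ = (vᵢ)`, `F₃ = (vⱼ)`, `i ≠ j`; `P = (vᵢ, vⱼ)` is a prime of
height two (`IsRsopPart.height_span_range`) contained in the prime `𝔭_γ = 𝓘(Γ)_x` (`γ ∈ Supp F` iff `F_x ≤ 𝔭_γ`), itself of height
`coheight γ = 2`; so `𝓘(Γ)_x = (vᵢ) + (vⱼ)` and (GEN₀) `SNCWithAt.centre_of_members` applies.  No host, no invariant and no dimension
bound are needed; a third member through `x` is already a coordinate hyperplane of the same system.

* `hasSNCWith_vanishingIdeal_of_two_members` — the statement above;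
* `coheight_subschemeι_eq_two` — on a host hypersurface `X = V(D)` (stalk `D_{ιζ} = (z)`, `z ∉ 𝔪²`, regular ambient stalk) a
  codimension-one point `ζ` of `X` is a codimension-two point `ι ζ` of `E` (feeds the lemma from the loop's data).

AI-written; AI review is weaker than expert review.

## References
* H. Matsumura, *Commutative Ring Theory* (1986), Thm. 14.2, Thm. 17.4. [Matsumura1987]
* J. Kollár, *Lectures on Resolution of Singularities* (2007), Def. 3.25. [Kollar2007]
* The Stacks Project, Tags 01J7, 02IZ. [StacksProject]
-/

-- `Summit.<Summit>.<Sub>.Theorems` with `Sub = Summit` (single-conjunct summit, D-0017)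
set_option linter.dupNamespace false

noncomputable section

open CategoryTheory CategoryTheory.Limits AlgebraicGeometry TopologicalSpace IsLocalRing
open Literature.AlgebraicGeometry.Resolution Scheme.IdealSheafData

namespace Summit.ResolutionOfSingularities.ResolutionOfSingularities.Theorems

universe u

namespace DepthLegal

/-- [OURS · L1 W5.2] **Rule (b): a double curve is a normal-crossings centre.** If a codimension-two point `γ` lies on two distinct
members of an snc boundary `ℬ`, then `ℬ` has simple normal crossings with the reduced curve `cl{γ}` (module docstring).
[cite: Matsumura1987, Thm. 17.4] [cite: Kollar2007, Def. 3.25] -/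
theorem hasSNCWith_vanishingIdeal_of_two_members {E : Scheme.{u}} {ℬ : List E.IdealSheafData} (hℬ : HasSNC ℬ)
    {F₂ F₃ : E.IdealSheafData} (h₂ : F₂ ∈ ℬ) (h₃ : F₃ ∈ ℬ) (hne : F₂ ≠ F₃)
    {γ : E} (hγ : Order.coheight γ = 2) (hγ₂ : γ ∈ F₂.support) (hγ₃ : γ ∈ F₃.support) :
    HasSNCWith ℬ (vanishingIdeal ⟨closure {γ}, isClosed_closure⟩) := by
  classical
  refine DepthSNC.hasSNCWith_of_pointwise hℬ fun x hx => ?_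
  have hγx : γ ⤳ x := mem_support_vanishingIdeal_closure_singleton_iff.mp hx
  have hx₂ : x ∈ F₂.support := hγx.mem_closed F₂.support.isClosed hγ₂
  have hx₃ : x ∈ F₃.support := hγx.mem_closed F₃.support.isClosed hγ₃
  have hsnc := hℬ.sncWithAt x
  refine hsnc.centre_of_members {F₂, F₃} ?_ ?_
  · rintro F (rfl | rfl)
    exacts [⟨h₂, hx₂⟩, ⟨h₃, hx₃⟩]
  -- the stalk identity `𝓘(cl γ)_x = F₂,x + F₃,x`
  obtain ⟨hreg, d, v, hd, hv, ⟨lab, hlab, hlabD⟩, -⟩ := hsnc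
  haveI := hreg
  have hpair : (⨆ F ∈ ({F₂, F₃} : Set E.IdealSheafData), stalkIdeal F x) = stalkIdeal F₂ x ⊔ stalkIdeal F₃ x := iSup_pair
  rw [hpair, stalkIdeal_vanishingIdeal_closure_singleton hγx]
  have hij : lab ⟨F₂, h₂, hx₂⟩ ≠ lab ⟨F₃, h₃, hx₃⟩ := fun h => hne (congrArg Subtype.val (hlab h))
  -- the pair of coordinates is part of a regular system of parameters
  let κ : Fin 2 → Fin d := ![lab ⟨F₂, h₂, hx₂⟩, lab ⟨F₃, h₃, hx₃⟩]
  have hκ0 : κ 0 = lab ⟨F₂, h₂, hx₂⟩ := rfl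
  have hκ1 : κ 1 = lab ⟨F₃, h₃, hx₃⟩ := rfl
  have hκ : Function.Injective κ := by
    intro a b hab
    fin_cases a <;> fin_cases b
    · rfl
    · exact absurd (hκ0.symm.trans (hab.trans hκ1)) hij
    · exact absurd (hκ0.symm.trans (hab.symm.trans hκ1)) hij
    · rfl
  have hz : IsRsopPart (v ∘ κ) := isRsopPart_comp_of_rsop hd v hv κ hκ
  have hrange : Set.range (v ∘ κ) = {v (lab ⟨F₂, h₂, hx₂⟩), v (lab ⟨F₃, h₃, hx₃⟩)} := by
    ext a
    simp only [Set.mem_range, Function.comp_apply, Fin.exists_fin_two, hκ0, hκ1, Set.mem_insert_iff,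
      Set.mem_singleton_iff, eq_comm]
  have hP : Ideal.span (Set.range (v ∘ κ)) = stalkIdeal F₂ x ⊔ stalkIdeal F₃ x := by
    rw [hrange, Ideal.span_insert, hlabD ⟨F₂, h₂, hx₂⟩, hlabD ⟨F₃, h₃, hx₃⟩]
  rw [← hP]
  -- `P ≤ 𝔭_γ`, both primes of height two
  have hle : Ideal.span (Set.range (v ∘ κ)) ≤ primeOfSpecializes hγx := by
    rw [hP]
    exact sup_le ((mem_support_iff_stalkIdeal_le_primeOfSpecializes hγx F₂).mp hγ₂)
      ((mem_support_iff_stalkIdeal_le_primeOfSpecializes hγx F₃).mp hγ₃)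
  haveI hPprime := hz.isPrime_span_range
  haveI : (primeOfSpecializes hγx).IsPrime := Ideal.IsPrime.comap _
  have hhtP : (Ideal.span (Set.range (v ∘ κ))).height = 2 := by exact_mod_cast hz.height_span_range
  have hht : (primeOfSpecializes hγx).height = 2 := by
    have h := coe_height_primeOfSpecializes hγx
    rw [hγ] at h
    exact_mod_cast h
  haveI : (Ideal.span (Set.range (v ∘ κ))).FiniteHeight :=
    (Ideal.span (Set.range (v ∘ κ))).finiteHeight_iff.mpr (Or.inr (by rw [hhtP]; exact ENat.coe_ne_top 2))
  symm
  by_contra hne'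
  have hlt := Ideal.height_strict_mono_of_isPrime (lt_of_le_of_ne hle hne')
  rw [hhtP, hht] at hlt
  exact lt_irrefl _ hlt

/-- [OURS · L1 W5.2] **A codimension-one point of a host hypersurface is a codimension-two point of the ambient scheme**:
`dim 𝒪_{E,ιζ} = dim 𝒪_{X,ζ} + 1` for `X = V(D)` with `D_{ιζ} = (z)`, `z ∉ 𝔪²` (Matsumura 14.2), and `dim 𝒪 = coheight`
(Stacks 02IZ). [cite: Matsumura1987, Thm. 14.2] [cite: StacksProject, Tag 02IZ] -/
theorem coheight_subschemeι_eq_two {E : Scheme.{u}} {D : E.IdealSheafData} (ζ : D.subscheme) (hζ : Order.coheight ζ = 1)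
    [IsRegularLocalRing (E.presheaf.stalk (D.subschemeι ζ))] {z : E.presheaf.stalk (D.subschemeι ζ)}
    (hDz : stalkIdeal D (D.subschemeι ζ) = Ideal.span {z}) (hz2 : z ∉ maximalIdeal (E.presheaf.stalk (D.subschemeι ζ)) ^ 2) :
    Order.coheight (D.subschemeι ζ) = 2 := by
  have hsurj : Function.Surjective (D.subschemeι.stalkMap ζ).hom := D.subschemeι.stalkMap_surjective ζ
  have hker : RingHom.ker (D.subschemeι.stalkMap ζ).hom = Ideal.span {z} := by rw [ker_stalkMap_subschemeι, hDz]
  have hzm : z ∈ maximalIdeal (E.presheaf.stalk (D.subschemeι ζ)) :=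
    (Ideal.span_singleton_le_iff_mem _).mp
      (hDz ▸ (mem_support_iff_stalkIdeal_le D _).mp (subschemeι_apply_mem_support D ζ))
  let e : (E.presheaf.stalk (D.subschemeι ζ) ⧸ Ideal.span {z}) ≃+* D.subscheme.presheaf.stalk ζ :=
    (Ideal.quotEquivOfEq hker.symm).trans (RingHom.quotientKerEquivOfSurjective hsurj)
  have h1 := (IsRegularLocalRing.quotient_span_singleton hzm hz2).2
  rw [ringKrullDim_eq_of_ringEquiv e, ringKrullDim_stalk_eq_coheight, ringKrullDim_stalk_eq_coheight, hζ] at h1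
  -- `h1 : (1 : ℕ∞) + 1 = coheight (ι ζ)` in `WithBot ℕ∞`
  have h2 : ((2 : ℕ∞) : WithBot ℕ∞) = (Order.coheight (D.subschemeι ζ) : WithBot ℕ∞) := by
    rw [← h1]; norm_cast
  exact_mod_cast h2.symm

end DepthLegal

end Summit.ResolutionOfSingularities.ResolutionOfSingularities.Theorems
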